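import Mathlib
import Summits.NavierStokesRegularity.NavierStokesRegularity.Theses.WakeRatchet
import HarnessLib

/-!
# `WakeRatchet.EternalRigidityViscBddOneOfActionSplit` — glue of the action-ceiling split of the
shared K2ᵛ (item stmt-NavierStokesRegularity-23199; pure logic)

**Statement.** `AdmissibleEternalBound → EternalRigidityViscOne → EternalRigidityViscBddOne`.

PROOF. Fix `R ≥ 1`. Child (A) gives a threshold `ε₁` below which every admissible viscous eternal
solution of an `E₂(R)` table is uniformly bounded; child (B) gives a threshold `ε₂` below which
robust blow-up yields an admissible viscous eternal solution surviving forward at `a = 1`. Below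
`min ε₁ ε₂` both apply: the extracted solution is admissible, surviving, and (by (A)) uniformly
bounded — which is `EternalRigidityViscBdd R 1`.

HONEST FRAMING: pure logic between the route's own statements about Tao-type MODEL lattice ODEs;
both children stay hypotheses (open cruxes); nothing here bears on Navier–Stokes regularity.
-/

noncomputable section

set_option linter.dupNamespace false

namespace Summit.NavierStokesRegularity.NavierStokesRegularity.Theorems

open Literature.Analysis.FluidPDE.TaoCascade in
open Summit.NavierStokesRegularity.NavierStokesRegularity.Theses.WakeRatchet in
/-- **Item stmt-NavierStokesRegularity-23199** (`WakeRatchet.EternalRigidityViscBddOneOfActionSplit`):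
the action-ceiling child (A) `AdmissibleEternalBound` and the unbounded-extraction child (B)
`EternalRigidityViscOne` imply the shared parent `EternalRigidityViscBddOne` (take the minimum of
the two thresholds). Pure logic. [this file] -/
theorem wakeRatchet_eternalRigidityViscBddOneOfActionSplit_proof :
    Summit.NavierStokesRegularity.NavierStokesRegularity.Theses.WakeRatchet.EternalRigidityViscBddOneOfActionSplit := by
  unfold Summit.NavierStokesRegularity.NavierStokesRegularity.Theses.WakeRatchet.EternalRigidityViscBddOneOfActionSplit
  intro hA hB R hR
  obtain ⟨ε₁, hε₁, h₁⟩ := hA R hR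
  obtain ⟨ε₂, hε₂, h₂⟩ := hB R hR
  refine ⟨min ε₁ ε₂, lt_min hε₁ hε₂, fun ε₀ hε₀ hle α X₀ hα hng => ?_⟩
  obtain ⟨νh, W, hW, hsurv⟩ := h₂ ε₀ hε₀ (hle.trans (min_le_right _ _)) α X₀ hα hng
  exact ⟨νh, W, hW, h₁ ε₀ hε₀ (hle.trans (min_le_left _ _)) α hα νh W hW, hsurv⟩

end Summit.NavierStokesRegularity.NavierStokesRegularity.Theorems

end
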